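import Mathlib
import Summits.Ventures.PercRepro2.K5HyperCoeffs
import Summits.Ventures.PercRepro2.K5TypedK3

/-!
# THE STAR COMPARISONS AS PROFILE SUMS OF p1's STATE KERNEL `KII` ON `K₅`
(blind cell PercRepro2, typer-1 g10; the dictionary between `K5HyperCoeffs.lean` and the (ii) kernel)

`typedCountHyper F z τ S₁ S₂ S₃ K` is the typed count of `K` with the edge sets `S₁, S₂, S₃` forced open in
the three copies (the lead's ruling 05:21Z (2): the hyperedge-augmented typed count IS the masked typed
count); `NOn S₁ S₂ S₃ k = Σ_{prof x y w = k} KII(x ∨ S₁, y ∨ S₂, w ∨ S₃)` is its instance for the cleared (ii)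
kernel `CaseOne.KII` at the `K₅` profile `k` with every edge typed (`F = univ`); `NOn_eq`: it is
`cPosOn − cNegOn` (`K5Typed.KII_apply`).
`NT1 D k` (the extra edge set `D` open in exactly one copy), `NT1e1 D P k` (`D` and `P` each in one copy,
`9` placements) and `NE3 P₁ P₂ P₃ k` (three edge sets each in one copy, `27` placements) are mine-1's
`N(H + T(1))`, `N(H + T(1) + e(1))`, `N(H + △(1,1,1))` with the hyperedge `T(1)` read as the triangle
`D = triMask T` forced open in one copy.  Hence, from the kernel certificates:

* **`M_real`**: `CertLE (kNegM D P) (kPosM D P) → ∀ k, NT1 D k ≤ NT1e1 D P k` — `M(H, T, e) ≥ 0`;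
* **`TvT_real`**: `CertLE (kNegTvT a b c) (kPosTvT a b c) → ∀ k, NT1 (triMask a b c) k ≤ NE3 (pairMask a b)
  (pairMask a c) (pairMask b c) k` — `TvT-(ii) ≥ 0`.
-/

namespace Summit.Ventures.PercRepro2

open Hub

namespace K5

section Dictionary

variable {R : Type*} [Field R] [LinearOrder R] [IsStrictOrderedRing R]

/-- **The hyperedge-augmented typed count** (the lead's ruling 05:21Z (2)): the typed count of the kernel
`K` on `K₅` with the edge sets `S₁, S₂, S₃` forced open in the three copies — a hyperedge `T(1)` open in
copy `i` is the triangle of `T` forced open in copy `i`. -/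
noncomputable def typedCountHyper (F : Finset (Fin 10)) (z : Config (Fin 10)) (τ : Fin 10 → ℕ)
    (S₁ S₂ S₃ : Fin 10 → Bool) (K : Config (Fin 10) → Config (Fin 10) → Config (Fin 10) → R) : R :=
  typedCount F z τ fun x y w => K (orOn S₁ x) (orOn S₂ y) (orOn S₃ w)

/-- The profile sum of the masked (ii) kernel: `Σ_{prof x y w = k} KII(x ∨ S₁, y ∨ S₂, w ∨ S₃)` — the
hyperedge-augmented typed count with every edge typed (`F = univ`, the profile `k`). -/
noncomputable def NOn (S₁ S₂ S₃ : Fin 10 → Bool) (k : Fin 10 → Fin 4) : R :=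
  typedCountHyper Finset.univ (fun _ => false) (fun e => (k e : ℕ)) S₁ S₂ S₃
    (CaseOne.KII (R := R) ends5 0 1 2 3 4)

/-- `N(H + D(1))`: the edge set `D` open in exactly one copy. -/
noncomputable def NT1 (D : Fin 10 → Bool) (k : Fin 10 → Fin 4) : R :=
  NOn D mNone mNone k + NOn mNone D mNone k + NOn mNone mNone D k

/-- `N(H + D(1) + P(1))`: `D` and `P` each open in exactly one copy (`9` placements). -/
noncomputable def NT1e1 (D P : Fin 10 → Bool) (k : Fin 10 → Fin 4) : R :=
  NOn (mOr D P) mNone mNone k + NOn D P mNone k + NOn D mNone P k + NOn P D mNone k +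
    NOn mNone (mOr D P) mNone k + NOn mNone D P k + NOn P mNone D k + NOn mNone P D k +
    NOn mNone mNone (mOr D P) k

/-- `N(H + P₁(1) + P₂(1) + P₃(1))`: three edge sets each open in exactly one copy (`27` placements). -/
noncomputable def NE3 (P₁ P₂ P₃ : Fin 10 → Bool) (k : Fin 10 → Fin 4) : R :=
  (NOn (mOr (mOr P₁ P₂) P₃) mNone mNone k + NOn (mOr P₁ P₂) P₃ mNone k +
    NOn (mOr P₁ P₂) mNone P₃ k + NOn (mOr P₁ P₃) P₂ mNone k + NOn P₁ (mOr P₂ P₃) mNone k +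
    NOn P₁ P₂ P₃ k + NOn (mOr P₁ P₃) mNone P₂ k + NOn P₁ P₃ P₂ k + NOn P₁ mNone (mOr P₂ P₃) k) +
  (NOn (mOr P₂ P₃) P₁ mNone k + NOn P₂ (mOr P₁ P₃) mNone k + NOn P₂ P₁ P₃ k +
    NOn P₃ (mOr P₁ P₂) mNone k + NOn mNone (mOr (mOr P₁ P₂) P₃) mNone k +
    NOn mNone (mOr P₁ P₂) P₃ k + NOn P₃ P₁ P₂ k + NOn mNone (mOr P₁ P₃) P₂ k +
    NOn mNone P₁ (mOr P₂ P₃) k) +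
  (NOn (mOr P₂ P₃) mNone P₁ k + NOn P₂ P₃ P₁ k + NOn P₂ mNone (mOr P₁ P₃) k +
    NOn P₃ P₂ P₁ k + NOn mNone (mOr P₂ P₃) P₁ k + NOn mNone P₂ (mOr P₁ P₃) k +
    NOn P₃ mNone (mOr P₁ P₂) k + NOn mNone P₃ (mOr P₁ P₂) k + NOn mNone mNone (mOr (mOr P₁ P₂) P₃) k)

omit [LinearOrder R] [IsStrictOrderedRing R] in
/-- The profile constraint with every edge typed. -/
lemma profile_univ (k : Fin 10 → Fin 4) :
    ∀ e, (k e : ℕ) = if e ∈ (Finset.univ : Finset (Fin 10)) then (k e : ℕ) else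
      if (fun _ : Fin 10 => false) e then 3 else 0 := by
  intro e
  simp

omit [LinearOrder R] [IsStrictOrderedRing R] in
/-- **The dictionary**: the masked profile sum of `KII` is `cPosOn − cNegOn`. -/
theorem NOn_eq (S₁ S₂ S₃ : Fin 10 → Bool) (k : Fin 10 → Fin 4) :
    NOn (R := R) S₁ S₂ S₃ k = ((cPosOn S₁ S₂ S₃ k : ℕ) : R) - ((cNegOn S₁ S₂ S₃ k : ℕ) : R) := by
  unfold NOn typedCountHyper
  have hK : (fun x y w => CaseOne.KII (R := R) ends5 0 1 2 3 4 (orOn S₁ x) (orOn S₂ y) (orOn S₃ w)) =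
      fun x y w =>
        (indR (fun ω => tABO (orOn S₁ ω)) x * indR (fun ω => tQ (orOn S₂ ω)) y *
            indR (fun ω => tPD (orOn S₃ ω)) w +
          indR (fun ω => tQB (orOn S₁ ω)) x * indR (fun ω => tPDoU (orOn S₂ ω)) y *
            indR (fun ω => tA (orOn S₃ ω)) w) -
        (indR (fun ω => tQB (orOn S₁ ω)) x * indR (fun ω => tAO (orOn S₂ ω)) y *
            indR (fun ω => tPD (orOn S₃ ω)) w +
          indR (fun ω => tAB (orOn S₁ ω)) x * indR (fun ω => tPDoU (orOn S₂ ω)) y *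
            indR (fun ω => tQ (orOn S₃ ω)) w) := by
    funext x y w
    rw [KII_apply]
    simp only [indR]
    ring
  rw [hK, typedCount_sub, typedCount_add, typedCount_add]
  simp only [typedCount_tables Finset.univ (fun _ => false) (fun e => (k e : ℕ)) k (profile_univ k)]
  unfold cPosOn cNegOn cOn
  push_cast
  ring

omit [LinearOrder R] [IsStrictOrderedRing R] in
/-- `N(H + D(1)) = cPosT1 − cNegT1`. -/
lemma NT1_eq (D : Fin 10 → Bool) (k : Fin 10 → Fin 4) :
    NT1 (R := R) D k = ((cPosT1 D k : ℕ) : R) - ((cNegT1 D k : ℕ) : R) := by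
  unfold NT1 cPosT1 cNegT1
  simp only [NOn_eq]
  push_cast
  ring

omit [LinearOrder R] [IsStrictOrderedRing R] in
/-- `N(H + D(1) + P(1)) = cPosT1e1 − cNegT1e1`. -/
lemma NT1e1_eq (D P : Fin 10 → Bool) (k : Fin 10 → Fin 4) :
    NT1e1 (R := R) D P k = ((cPosT1e1 D P k : ℕ) : R) - ((cNegT1e1 D P k : ℕ) : R) := by
  unfold NT1e1 cPosT1e1 cNegT1e1
  simp only [NOn_eq]
  push_cast
  ring

omit [LinearOrder R] [IsStrictOrderedRing R] in
/-- `N(H + P₁(1) + P₂(1) + P₃(1)) = cPosE3 − cNegE3`. -/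
lemma NE3_eq (P₁ P₂ P₃ : Fin 10 → Bool) (k : Fin 10 → Fin 4) :
    NE3 (R := R) P₁ P₂ P₃ k = ((cPosE3 P₁ P₂ P₃ k : ℕ) : R) - ((cNegE3 P₁ P₂ P₃ k : ℕ) : R) := by
  unfold NE3 cPosE3 cNegE3 cPosE3a cPosE3b cPosE3c cNegE3a cNegE3b cNegE3c
  simp only [NOn_eq]
  push_cast
  ring

/-- **`M(H, T, e) ≥ 0` at every `K₅` profile, as profile sums of `KII`**: `N(H + D(1)) ≤ N(H + D(1) + P(1))`
from the certificate. -/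
theorem M_real (D P : Fin 10 → Bool) (hc : CertLE (kNegM D P) (kPosM D P)) (k : Fin 10 → Fin 4) :
    NT1 (R := R) D k ≤ NT1e1 (R := R) D P k := by
  have h := cNegM_le_cPosM D P hc k
  unfold cNegM cPosM at h
  rw [NT1_eq, NT1e1_eq, sub_le_sub_iff]
  exact_mod_cast (by omega : cPosT1 D k + cNegT1e1 D P k ≤ cPosT1e1 D P k + cNegT1 D k)

/-- **`TvT-(ii) ≥ 0` at every `K₅` profile, as profile sums of `KII`**: `N(H + T(1)) ≤ N(H + △(1,1,1))`
from the certificate. -/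
theorem TvT_real (a b c : ℕ) (hc : CertLE (kNegTvT a b c) (kPosTvT a b c)) (k : Fin 10 → Fin 4) :
    NT1 (R := R) (triMask a b c) k ≤ NE3 (R := R) (pairMask a b) (pairMask a c) (pairMask b c) k := by
  have h := cNegTvT_le_cPosTvT a b c hc k
  unfold cNegTvT cPosTvT at h
  rw [NT1_eq, NE3_eq, sub_le_sub_iff]
  exact_mod_cast (by omega : cPosT1 (triMask a b c) k + cNegE3 (pairMask a b) (pairMask a c) (pairMask b c) k ≤
    cPosE3 (pairMask a b) (pairMask a c) (pairMask b c) k + cNegT1 (triMask a b c) k)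

end Dictionary

end K5

end Summit.Ventures.PercRepro2
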